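import Literature.NumberTheory.EllipticCurves.IsogenyLocalPointsMaps
import Literature.NumberTheory.EllipticCurves.VariableChangePointsMap
import Literature.NumberTheory.EllipticCurves.HeegnerPointsOfConductor
import HarnessLib

/-!
# Crux `GordTwoRankZeroOffCaseOne` (+ twin `MultLower`), line `three_field_road`: the GENUS TRANSPORT of
# points along the twist `Θ : E′ ≅ C₂ • ((D • E′) ⊗ χ_d)` over any field containing `θ = √d`

Cell `bsd-addord`, lead seat `cruxlead-19357-g0`; HELPER for the registered stub `stub_genusKolyvaginPointsR[M]`
(`Cruxes/GordTwoRankZeroOffCaseOne/Lines/three_field_road.lean` v8, `Cruxes/MultLower/Lines/tame_roads_mult.lean`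
v7; lead report 4 §2), landed `--supports … --as helper`. THEOREMS ONLY (no definition, no named fact, no `sorry`).

## What

The line's Kolyvagin system for `Wd = C₂ • ((D • E′) ⊗ χ_{d₁})` over the `p`-ramified field `K″` is the
transport of the CM points of the fourth curve `E′` along the `ℚ(θ)`-isomorphism
`Θ_L = (C₂)_* ∘ ι_θ⁻¹ ∘ D_* : E′(L) → Wd(L)` (`θ² = d₁`, `θ ∈ L`; `ι_θ` = the tree's
`WeierstrassCurve.untwistEquivAt`, `D_*`, `(C₂)_*` = `VariableChange.pointEquivBaseChange`). This file is
the transport algebra, for an arbitrary `ℚ`-field `L` (later `L = K″[m]`):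
* §1 `Θ_L` is written OUT (no `def`): `(C₂)_* (ι_θ⁻¹ (D_* P))` with `ι_θ = untwistEquivAt`; `twist_apply_eq` (agreement with the
  composite displayed in the line's `GenusHeegnerSetting.hP` / `SchneiderFree.exists_descent_twistedHeegner`), injectivity;
* §2 FUNCTORIALITY: for a `ℚ`-algebra map `f : L → L′` with `f θ = θ′` resp. `f θ = −θ′`:
  `f_* ∘ Θ_L = Θ_{L′} ∘ f_*` resp. `= −Θ_{L′} ∘ f_*` (`map_twist_of_eq`, `map_twist_of_eq_neg`), and the
  signed form `map_twist_of_eq_intCast_mul` (`f θ = u θ′`, `u = ±1`); every `f` does one of the two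
  (`apply_sqrt_eq_or_eq_neg`: `(fθ)² = d = θ′²`);
* §3 consequences used by the labels: `Θ` commutes with sums and integer multiples, with automorphisms
  fixing `θ` (the subgroup `Gal(L/ℚ(θ))` — for `L = K″[m]` it contains `G_m = Gal(K″[m]/K″[1])` since
  `θ ∈ K″[1]`), and anticommutes up to the sign `u(σ) = σθ/θ` in general
  (`pointGalHom_twist`), generalising `SchneiderFree.map_twistIso_eq_smul` (there: `σ ∈ Gal(K[c]/K)` and
  a character `s`) to arbitrary automorphisms and to maps between two fields.

HONEST FRAMING: pure algebra of Weierstrass equations (Silverman X.2 Prop. 2.4, X.5 Cor. 5.4); nothing about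
Heegner points, Euler systems or BSD is asserted; no stub is closed by this file alone. BSD is not proved by
any of this.

References: [cite: SilvermanAEC2009, X.2 Prop. 2.4, X.5 Cor. 5.4 (iii), III.3.1 (b)].
presearch: n/a (tree algebra: `untwistEquivAt`, `map_untwistEquivAt_(symm_)of_eq(_neg)`,
`VariableChange.pointEquivBaseChange_map`; `lean search 'pointGalHom_twist|map_twistIso_eq_smul'` → SchneiderFree's
level-`c`, `ringClassGal`-keyed form only).
-/

noncomputable section

open scoped Classical

set_option linter.dupNamespace false
set_option autoImplicit false

namespace Summit.BirchSwinnertonDyer.BirchSwinnertonDyer.Theorems.GenusKolyvagin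

open WeierstrassCurve Literature.NumberTheory.EllipticCurves

universe v w

variable (E' : WeierstrassCurve ℚ) (D C₂ : VariableChange ℚ) [(D • E').IsCharNeTwoNF] (d : ℚ)
  {L : Type v} [Field L] [Algebra ℚ L] {θ : L}
  {L' : Type w} [Field L'] [Algebra ℚ L'] {θ' : L'}

/-! ## §1 The transport map `Θ_L = (C₂)_* ∘ ι_θ⁻¹ ∘ D_*` (written out) -/

/-- `Θ_L P` (with `ι_θ⁻¹ = (untwistEquivAt _).symm`) is the composite displayed in
`SchneiderFree.exists_descent_twistedHeegner` / `GenusHeegnerSetting.hP` (with `ι_θ⁻¹` spelled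
`(pointEquiv _ (untwistAt hθ)).symm ∘ (congrEquiv _).symm`). [folklore] -/
theorem twist_apply_eq (hθ2 : θ ^ 2 = algebraMap ℚ L d) (hθ : θ ≠ 0)
    (P : (E'.baseChange L).toAffine.Point) :
    VariableChange.pointEquivBaseChange ((D • E').quadraticTwist d) C₂ L
        (((D • E').untwistEquivAt hθ2 hθ).symm (VariableChange.pointEquivBaseChange E' D L P)) =
      VariableChange.pointEquivBaseChange ((D • E').quadraticTwist d) C₂ L
        ((VariableChange.pointEquiv (((D • E').quadraticTwist d).baseChange L) (untwistAt hθ)).symm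
          ((Affine.Point.congrEquiv (untwistAt_smul_eq (D • E') hθ2 hθ)).symm
            (VariableChange.pointEquivBaseChange E' D L P))) :=
  rfl

/-- `Θ_L` is injective (a composite of bijections). [folklore] -/
theorem twist_injective (hθ2 : θ ^ 2 = algebraMap ℚ L d) (hθ : θ ≠ 0) :
    Function.Injective fun P : (E'.baseChange L).toAffine.Point =>
      VariableChange.pointEquivBaseChange ((D • E').quadraticTwist d) C₂ L
        (((D • E').untwistEquivAt hθ2 hθ).symm (VariableChange.pointEquivBaseChange E' D L P)) :=
  fun _ _ h =>
    (VariableChange.pointEquivBaseChange E' D L).injective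
      (((D • E').untwistEquivAt hθ2 hθ).symm.injective
        ((VariableChange.pointEquivBaseChange ((D • E').quadraticTwist d) C₂ L).injective h))

/-! ## §2 Functoriality along `ℚ`-algebra maps -/

/-- A `ℚ`-algebra map carries a square root of `d` to `±` any square root of `d` in the target.
[folklore] -/
theorem apply_sqrt_eq_or_eq_neg (hθ2 : θ ^ 2 = algebraMap ℚ L d) (hθ'2 : θ' ^ 2 = algebraMap ℚ L' d)
    (f : L →ₐ[ℚ] L') : f θ = θ' ∨ f θ = -θ' := by
  apply sq_eq_sq_iff_eq_or_eq_neg.mp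
  rw [← map_pow, hθ2, hθ'2, AlgHom.commutes]

/-- **The sign of a `ℚ`-algebra map on `θ`**: there is `u = ±1` with `f θ = u·θ′`. [folklore] -/
theorem exists_sign_apply_sqrt (hθ2 : θ ^ 2 = algebraMap ℚ L d) (hθ'2 : θ' ^ 2 = algebraMap ℚ L' d)
    (f : L →ₐ[ℚ] L') : ∃ u : ℤ, (u = 1 ∨ u = -1) ∧ f θ = (u : L') * θ' := by
  rcases apply_sqrt_eq_or_eq_neg d hθ2 hθ'2 f with h | h
  · exact ⟨1, Or.inl rfl, by rw [h, Int.cast_one, one_mul]⟩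
  · exact ⟨-1, Or.inr rfl, by rw [h, Int.cast_neg, Int.cast_one, neg_one_mul]⟩

/-- **`f_* ∘ Θ_L = Θ_{L′} ∘ f_*` when `f θ = θ′.`** [cite: SilvermanAEC2009, X.5 Cor. 5.4 (iii)] -/
theorem map_twist_of_eq (hθ2 : θ ^ 2 = algebraMap ℚ L d) (hθ : θ ≠ 0)
    (hθ'2 : θ' ^ 2 = algebraMap ℚ L' d) (hθ' : θ' ≠ 0) (f : L →ₐ[ℚ] L') (hf : f θ = θ')
    (P : (E'.baseChange L).toAffine.Point) :
    Affine.Point.map f (VariableChange.pointEquivBaseChange ((D • E').quadraticTwist d) C₂ L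
        (((D • E').untwistEquivAt hθ2 hθ).symm (VariableChange.pointEquivBaseChange E' D L P))) =
      VariableChange.pointEquivBaseChange ((D • E').quadraticTwist d) C₂ L'
        (((D • E').untwistEquivAt hθ'2 hθ').symm
          (VariableChange.pointEquivBaseChange E' D L' (Affine.Point.map f P))) := by
  rw [VariableChange.pointEquivBaseChange_map, map_untwistEquivAt_symm_of_eq (D • E') hθ2 hθ hθ'2 hθ' f hf,
    VariableChange.pointEquivBaseChange_map]

/-- **`f_* ∘ Θ_L = −Θ_{L′} ∘ f_*` when `f θ = −θ′.`** [cite: SilvermanAEC2009, X.5 Cor. 5.4 (iii)] -/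
theorem map_twist_of_eq_neg (hθ2 : θ ^ 2 = algebraMap ℚ L d) (hθ : θ ≠ 0)
    (hθ'2 : θ' ^ 2 = algebraMap ℚ L' d) (hθ' : θ' ≠ 0) (f : L →ₐ[ℚ] L') (hf : f θ = -θ')
    (P : (E'.baseChange L).toAffine.Point) :
    Affine.Point.map f (VariableChange.pointEquivBaseChange ((D • E').quadraticTwist d) C₂ L
        (((D • E').untwistEquivAt hθ2 hθ).symm (VariableChange.pointEquivBaseChange E' D L P))) =
      -VariableChange.pointEquivBaseChange ((D • E').quadraticTwist d) C₂ L'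
        (((D • E').untwistEquivAt hθ'2 hθ').symm
          (VariableChange.pointEquivBaseChange E' D L' (Affine.Point.map f P))) := by
  rw [VariableChange.pointEquivBaseChange_map, map_untwistEquivAt_symm_of_eq_neg (D • E') hθ2 hθ hθ'2 hθ' f hf,
    map_neg, VariableChange.pointEquivBaseChange_map]

/-- **Signed functoriality**: if `f θ = u·θ′` with `u = ±1` then `f_* (Θ_L P) = u • Θ_{L′}(f_* P)`.
[cite: SilvermanAEC2009, X.5 Cor. 5.4 (iii)] -/
theorem map_twist_of_eq_intCast_mul (hθ2 : θ ^ 2 = algebraMap ℚ L d) (hθ : θ ≠ 0)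
    (hθ'2 : θ' ^ 2 = algebraMap ℚ L' d) (hθ' : θ' ≠ 0) (f : L →ₐ[ℚ] L') {u : ℤ} (hu : u = 1 ∨ u = -1)
    (hf : f θ = (u : L') * θ') (P : (E'.baseChange L).toAffine.Point) :
    Affine.Point.map f (VariableChange.pointEquivBaseChange ((D • E').quadraticTwist d) C₂ L
        (((D • E').untwistEquivAt hθ2 hθ).symm (VariableChange.pointEquivBaseChange E' D L P))) =
      u • VariableChange.pointEquivBaseChange ((D • E').quadraticTwist d) C₂ L'
        (((D • E').untwistEquivAt hθ'2 hθ').symm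
          (VariableChange.pointEquivBaseChange E' D L' (Affine.Point.map f P))) := by
  rcases hu with rfl | rfl
  · rw [one_smul]
    exact map_twist_of_eq E' D C₂ d hθ2 hθ hθ'2 hθ' f (by rw [hf, Int.cast_one, one_mul]) P
  · rw [neg_smul, one_smul]
    exact map_twist_of_eq_neg E' D C₂ d hθ2 hθ hθ'2 hθ' f
      (by rw [hf, Int.cast_neg, Int.cast_one, neg_one_mul]) P

/-! ## §3 Automorphisms: (anti)equivariance of `Θ_L` -/

/-- **`σ(Θ P) = u(σ) • Θ(σ P)` for every `σ ∈ Aut_ℚ(L)`, `u(σ) = σθ/θ = ±1`** (Silverman X.2 Prop. 2.4: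
the twist isomorphism is defined over `ℚ(θ)`, and `σ` acts on it through the quadratic character).
Generalises `SchneiderFree.map_twistIso_eq_smul` (`σ ∈ Gal(K[c]/K)` there).
[cite: SilvermanAEC2009, X.2 Prop. 2.4, X.5 Cor. 5.4] -/
theorem pointGalHom_twist (hθ2 : θ ^ 2 = algebraMap ℚ L d) (hθ : θ ≠ 0) (σ : L ≃ₐ[ℚ] L) {u : ℤ}
    (hu : u = 1 ∨ u = -1) (hσ : σ θ = (u : L) * θ) (P : (E'.baseChange L).toAffine.Point) :
    pointGalHom (C₂ • (D • E').quadraticTwist d) L σ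
        (VariableChange.pointEquivBaseChange ((D • E').quadraticTwist d) C₂ L
          (((D • E').untwistEquivAt hθ2 hθ).symm (VariableChange.pointEquivBaseChange E' D L P))) =
      u • VariableChange.pointEquivBaseChange ((D • E').quadraticTwist d) C₂ L
        (((D • E').untwistEquivAt hθ2 hθ).symm
          (VariableChange.pointEquivBaseChange E' D L (pointGalHom E' L σ P))) := by
  rw [pointGalHom_apply, pointGalHom_apply]
  exact map_twist_of_eq_intCast_mul E' D C₂ d hθ2 hθ hθ2 hθ (σ : L →ₐ[ℚ] L) hu hσ P

/-- **`Θ` is `σ`-equivariant for `σ` fixing `θ`.** [cite: SilvermanAEC2009, X.5 Cor. 5.4] -/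
theorem pointGalHom_twist_of_apply_eq (hθ2 : θ ^ 2 = algebraMap ℚ L d) (hθ : θ ≠ 0) (σ : L ≃ₐ[ℚ] L)
    (hσ : σ θ = θ) (P : (E'.baseChange L).toAffine.Point) :
    pointGalHom (C₂ • (D • E').quadraticTwist d) L σ
        (VariableChange.pointEquivBaseChange ((D • E').quadraticTwist d) C₂ L
          (((D • E').untwistEquivAt hθ2 hθ).symm (VariableChange.pointEquivBaseChange E' D L P))) =
      VariableChange.pointEquivBaseChange ((D • E').quadraticTwist d) C₂ L
        (((D • E').untwistEquivAt hθ2 hθ).symm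
          (VariableChange.pointEquivBaseChange E' D L (pointGalHom E' L σ P))) := by
  rw [pointGalHom_apply, pointGalHom_apply]
  exact map_twist_of_eq E' D C₂ d hθ2 hθ hθ2 hθ (σ : L →ₐ[ℚ] L) hσ P

/-- A sum of `σ`-translates is transported term by term when the `σ`'s fix `θ`:
`Θ(Σ_{g ∈ G} g·P) = Σ_{g ∈ G} g·Θ(P)` (label (B4): `G = G_ℓ ≤ Gal(K″[m]/K″[1])` fixes `θ ∈ K″[1]`).
[folklore] -/
theorem twist_sum_pointGalHom_of_apply_eq (hθ2 : θ ^ 2 = algebraMap ℚ L d) (hθ : θ ≠ 0)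
    (G : Finset (L ≃ₐ[ℚ] L)) (hG : ∀ g ∈ G, g θ = θ) (P : (E'.baseChange L).toAffine.Point) :
    VariableChange.pointEquivBaseChange ((D • E').quadraticTwist d) C₂ L
        (((D • E').untwistEquivAt hθ2 hθ).symm
          (VariableChange.pointEquivBaseChange E' D L (∑ g ∈ G, pointGalHom E' L g P))) =
      ∑ g ∈ G, pointGalHom (C₂ • (D • E').quadraticTwist d) L g
        (VariableChange.pointEquivBaseChange ((D • E').quadraticTwist d) C₂ L
          (((D • E').untwistEquivAt hθ2 hθ).symm (VariableChange.pointEquivBaseChange E' D L P))) := by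
  rw [map_sum, map_sum, map_sum]
  exact Finset.sum_congr rfl fun g hg => (pointGalHom_twist_of_apply_eq E' D C₂ d hθ2 hθ g (hG g hg) P).symm

/-- A SIGNED sum of translates is transported to a PLAIN sum when the signs are the characters of the
`σ`'s on `θ`: `Θ(Σ_i s_i·g_i·P) = Σ_i g_i·Θ(P)` for `g_i θ = s_i θ`, `s_i = ±1` (the genus-point identity
behind label (B2)). [cite: SilvermanAEC2009, X.2 Prop. 2.4] -/
theorem twist_sum_smul_pointGalHom {ι : Type*} (hθ2 : θ ^ 2 = algebraMap ℚ L d) (hθ : θ ≠ 0)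
    (T : Finset ι) (g : ι → (L ≃ₐ[ℚ] L)) (s : ι → ℤ) (hs : ∀ i ∈ T, s i = 1 ∨ s i = -1)
    (hg : ∀ i ∈ T, g i θ = (s i : L) * θ) (P : (E'.baseChange L).toAffine.Point) :
    VariableChange.pointEquivBaseChange ((D • E').quadraticTwist d) C₂ L
        (((D • E').untwistEquivAt hθ2 hθ).symm
          (VariableChange.pointEquivBaseChange E' D L (∑ i ∈ T, s i • pointGalHom E' L (g i) P))) =
      ∑ i ∈ T, pointGalHom (C₂ • (D • E').quadraticTwist d) L (g i)
        (VariableChange.pointEquivBaseChange ((D • E').quadraticTwist d) C₂ L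
          (((D • E').untwistEquivAt hθ2 hθ).symm (VariableChange.pointEquivBaseChange E' D L P))) := by
  rw [map_sum, map_sum, map_sum]
  refine Finset.sum_congr rfl fun i hi => ?_
  rw [map_zsmul, map_zsmul, map_zsmul, pointGalHom_twist E' D C₂ d hθ2 hθ (g i) (hs i hi) (hg i hi)]

end Summit.BirchSwinnertonDyer.BirchSwinnertonDyer.Theorems.GenusKolyvagin
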